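import Mathlib.Geometry.Manifold.PartitionOfUnity
import Mathlib.Analysis.SpecialFunctions.SmoothTransition
import Literature.Geometry.Symplectic.McleanDivisorComplementConvexFourExhaustion
import Literature.Geometry.Kaehler.PluriharmonicLog
import Literature.Geometry.Kaehler.MayerVietoris
import HarnessLib

/-!
# McLean's convexity of a divisor complement: gluing a local correction of the primitive

Topic `Literature/Geometry/Symplectic`; proofs file (layer A2, soft part) of the fact seat of
`Literature.Geometry.Symplectic.mclean_divisorComplement_convex_four`
(`McleanDivisorComplementConvexFour.lean`; M. McLean, *The growth rate of symplectic homology and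
affine varieties*, GAFA 22 (2012), Lemma 5.17), continuing
`McleanDivisorComplementConvexFourExhaustion.lean` (layer A3).

In the printed proof of Lemma 5.17 the given primitive `θ` of `ω` on `M ∖ S` is corrected to
`θ + df`, the function `f` being produced on a tubular neighbourhood `US` of the divisor `S` only
(the parametrised Poincaré lemma on the fibres, p. 36 of arXiv:1011.2542v3) and then cut off
("by extending `h` … we can subtract `π^* h` from `f''` so that `f'' = 0` near …"), and the
exhausting function is `ν(r)` for the radius `r` of the tube, extended "by zero away from `US_i`".
This file performs exactly these two soft steps, in the tree's `MForm` vocabulary and for one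
divisor in real dimension `4`, reducing the fact to LOCAL data near the divisor:

**`exists_convex_of_local_correction`.**  Let `N` be a compact `4`-manifold, `U ⊆ N` open with
closed complement `B = N ∖ U` ("the divisor"), `s` a `2`-form on `N` non-degenerate along `U`,
`θ` a smooth `1`-form on `U` with `dθ = s|_U`.  Suppose that on an open `V ⊇ B` we are given a
function `r2` ("radius squared"), smooth at the points of `V`, with `{r2 > 0} ∩ V = U ∩ V`, and
a function `h`, smooth at the points of `U ∩ V`, such that for some `δ > 0` the corrected form
`θ - dh` is positive on the `s`-dual `X_{r2}` of `d(r2)` at every point of `U ∩ V ∩ {r2 < δ}`.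
Then the conclusion of `mclean_divisorComplement_convex_four` holds: there are a smooth primitive
`λ` of `s|_U`, a smooth exhausting `g : U → ℝ` and `C` with `dg(X_λ) > 0` on `{g ≥ C}`.

Proof: with a smooth `ρ₀ ≥ 0` on `N` whose support is `U` (Mathlib's
`IsOpen.exists_contMDiff_support_eq`) and a cut-off `χ = smoothTransition ((2ε - ρ₀)/ε)`
(`= 1` on `{ρ₀ ≤ ε}`, `= 0` on `{ρ₀ ≥ 2ε}`, `{ρ₀ < 3ε} ⊆ V` by compactness), put
`λ = θ - d(χ h)` and `ρ = χ r2 + (1 - χ) ρ₀`; then `λ` is a smooth primitive of `s|_U`,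
`{ρ > 0} = U`, and on `{ρ₀ < ε}` one has `λ = θ - dh`, `ρ = r2`; since `ρ` is bounded below on
the compact `{ρ₀ ≥ ε} ⊆ U`, the hypothesis gives `λ(X_ρ) > 0` on `{0 < ρ < δ'}`, and layer A3
(`exists_exhaustion_of_definingFunction`) supplies `g = 1/ρ`.

Everything is proved; no definitions, no named facts (D-0026).

## References

* M. McLean, *The growth rate of symplectic homology and affine varieties*, Geom. Funct. Anal. 22
  (2012) 369–442, Lemma 5.17 (proof). [Mclean2012]
-/

noncomputable section

open scoped Manifold ContDiff Topology
open Set Function Filter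

namespace Literature.Geometry.Symplectic

open Literature.Geometry.Kaehler Literature.Geometry.Manifold

/-! ### Generic helpers -/

section Helpers

variable {X : Type*} [TopologicalSpace X]

/-- A continuous function positive on a compact set is bounded below there by a positive
constant (also when the set is empty). [folklore] -/
theorem exists_pos_forall_le_of_isCompact {K : Set X} (hK : IsCompact K) {f : X → ℝ}
    (hf : Continuous f) (hpos : ∀ y ∈ K, 0 < f y) : ∃ m : ℝ, 0 < m ∧ ∀ y ∈ K, m ≤ f y := by
  rcases K.eq_empty_or_nonempty with hKe | hKn
  · exact ⟨1, one_pos, fun y hy => by simp [hKe] at hy⟩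
  · obtain ⟨y₀, hy₀, hmin⟩ := hK.exists_isMinOn hKn hf.continuousOn
    exact ⟨f y₀, hpos y₀ hy₀, fun y hy => hmin hy⟩

/-- **Sublevel sets of a defining function shrink to the divisor**: if `ρ₀ > 0` exactly on the
open set `U` of the compact space `X` and `W` is an open set containing `X ∖ U`, then
`{ρ₀ < ε} ⊆ W` for some `ε > 0` (`ρ₀` is bounded below on the compact `X ∖ W ⊆ U`).
[folklore] -/
theorem exists_pos_lt_imp_mem [CompactSpace X] {U : TopologicalSpace.Opens X} {ρ₀ : X → ℝ}
    (hρ₀ : Continuous ρ₀) (hρ₀U : ∀ x, 0 < ρ₀ x ↔ x ∈ U) {W : Set X} (hW : IsOpen W)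
    (hUW : (U : Set X)ᶜ ⊆ W) : ∃ ε : ℝ, 0 < ε ∧ ∀ x, ρ₀ x < ε → x ∈ W := by
  have hK : IsCompact Wᶜ := hW.isClosed_compl.isCompact
  have hKU : ∀ y ∈ Wᶜ, 0 < ρ₀ y := fun y hy =>
    (hρ₀U y).2 (not_notMem.1 fun hyU => hy (hUW hyU))
  obtain ⟨m, hm, hmK⟩ := exists_pos_forall_le_of_isCompact hK hρ₀ hKU
  exact ⟨m, hm, fun x hx => not_notMem.1 fun hxW => (hmK x hxW).not_gt hx⟩

variable {E : Type*} [NormedAddCommGroup E] [NormedSpace ℝ E] {H : Type*} [TopologicalSpace H]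
  {I : ModelWithCorners ℝ E H} {M : Type*} [TopologicalSpace M] [ChartedSpace H M]

/-- **A smooth cut-off adapted to a function**: for `ρ₀ : M → ℝ` smooth and `ε > 0` there is a
smooth `χ : M → [0, 1]` with `χ = 1` on `{ρ₀ ≤ ε}` and `χ = 0` on `{2ε ≤ ρ₀}`, namely
`χ = smoothTransition ((2ε - ρ₀)/ε)` (Mathlib's `Real.smoothTransition`). [folklore] -/
theorem exists_cutoff_of_contMDiff {ρ₀ : M → ℝ} (hρ₀ : ContMDiff I 𝓘(ℝ, ℝ) ∞ ρ₀) {ε : ℝ}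
    (hε : 0 < ε) :
    ∃ χ : M → ℝ, ContMDiff I 𝓘(ℝ, ℝ) ∞ χ ∧ (∀ x, ρ₀ x ≤ ε → χ x = 1) ∧
      (∀ x, 2 * ε ≤ ρ₀ x → χ x = 0) ∧ (∀ x, 0 ≤ χ x) ∧ ∀ x, χ x ≤ 1 := by
  refine ⟨fun x => Real.smoothTransition ((2 * ε - ρ₀ x) * ε⁻¹), ?_, ?_, ?_,
    fun x => Real.smoothTransition.nonneg _, fun x => Real.smoothTransition.le_one _⟩
  · exact Real.smoothTransition.contDiff.comp_contMDiff
      ((contMDiff_const.sub hρ₀).mul contMDiff_const)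
  · intro x hx
    apply Real.smoothTransition.one_of_one_le
    rw [le_mul_inv_iff₀ hε]
    linarith
  · intro x hx
    apply Real.smoothTransition.zero_of_nonpos
    exact mul_nonpos_of_nonpos_of_nonneg (by linarith) (inv_nonneg.2 hε.le)

variable [IsManifold I ∞ M]

/-- **`d` of a `0`-form is the differential** (manifold `mfderiv` form of the tree's
`mextDeriv_ofFun_apply`): for `F : M → ℝ` differentiable at `x`,
`d(F) x v = mfderiv F x (v 0)` (Warner (1983), 2.20(a)). [folklore] -/
theorem mextDeriv_ofFun_apply_eq_mfderiv {F : M → ℝ} {x : M}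
    (hF : MDifferentiableAt I 𝓘(ℝ, ℝ) F x) (v : Fin 1 → TangentSpace I x) :
    mextDeriv (MForm.ofFun I F) x v = mfderiv I 𝓘(ℝ, ℝ) F x (v 0) := by
  rw [mextDeriv_ofFun_apply, hF.mfderiv]
  simp only [writtenInExtChartAt, extChartAt_model_space_eq_id, PartialEquiv.refl_coe,
    Function.id_comp]
  rfl

end Helpers

/-! ### Defining functions of the divisor -/

section Defining

variable {N : Type*} [TopologicalSpace N] [ChartedSpace (EuclideanSpace ℝ (Fin 4)) N]
  [IsManifold (𝓡 4) ∞ N] [T2Space N] [CompactSpace N]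

/-- **A global defining function of the divisor**: for `U ⊆ N` open there is a smooth
`ρ₀ : N → ℝ`, `ρ₀ ≥ 0`, with `{ρ₀ > 0} = U` (Mathlib's `IsOpen.exists_contMDiff_support_eq`).
[folklore] -/
theorem exists_contMDiff_pos_iff_mem (U : TopologicalSpace.Opens N) :
    ∃ ρ₀ : N → ℝ, ContMDiff (𝓡 4) 𝓘(ℝ, ℝ) ∞ ρ₀ ∧ (∀ x, 0 ≤ ρ₀ x) ∧ ∀ x, 0 < ρ₀ x ↔ x ∈ U := by
  obtain ⟨ρ₀, hsupp, hρ₀, hnn⟩ :=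
    IsOpen.exists_contMDiff_support_eq (I := 𝓡 4) (n := (⊤ : ℕ∞)) U.isOpen
  refine ⟨ρ₀, hρ₀, hnn, fun x => ?_⟩
  rw [(hnn x).lt_iff_ne', ← Function.mem_support, hsupp]
  rfl

end Defining

/-! ### The gluing theorem -/

section Gluing

variable {N : Type*} [TopologicalSpace N] [ChartedSpace (EuclideanSpace ℝ (Fin 4)) N]
  [IsManifold (𝓡 4) ∞ N] [T2Space N] [CompactSpace N]

/-- **McLean's Lemma 5.17 reduced to a local correction near the divisor** (McLean 2012, proof
of Lemma 5.17: the correction `f''` of `θ` produced on the tube `US` and cut off, the exhausting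
function `ν(r)` extended by zero).  `N` a compact `4`-manifold, `U ⊆ N` open, `s` a `2`-form on
`N` non-degenerate along `U`, `θ` a smooth `1`-form on `U` with `dθ = s|_U`; `V ⊇ N ∖ U` open,
`r2` smooth at the points of `V` with `{r2 > 0} ∩ V = U ∩ V`, `h` smooth at the points of
`U ∩ V`, and `δ > 0` such that `(θ - dh)(X) > 0` whenever `x ∈ U ∩ V`, `r2 x < δ` and
`s(X, ·) = d(r2)_x` (`dh` being `d` of the `0`-form `MForm.ofFun (𝓡 4) h`).  Then there are
a smooth `1`-form `λ` on `U` with `dλ = s|_U`, a smooth `g : U → ℝ` with compact sublevel sets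
and `C` such that `dg_x(X) > 0` whenever `g x ≥ C` and `dλ_x(X, ·) = λ_x` — the conclusion of
`mclean_divisorComplement_convex_four`.  (`λ = θ - d(χh)`, `g = 1/(χ r2 + (1 - χ) ρ₀)` for a
defining function `ρ₀` of `N ∖ U` and a cut-off `χ`.)
[cite: Mclean2012, Lemma 5.17 (proof)] -/
theorem exists_convex_of_local_correction {U : TopologicalSpace.Opens N} {V : Set N}
    (s : MForm (𝓡 4) N ℝ 2) (θ : MForm (𝓡 4) U ℝ 1) (r2 h : N → ℝ) {δ : ℝ}
    (hnd : ∀ x : U, ∀ v : EuclideanSpace ℝ (Fin 4), v ≠ 0 →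
      ∃ w : EuclideanSpace ℝ (Fin 4), s (x : N) ![v, w] ≠ 0)
    (hθ : IsSmoothForm θ) (hdθ : mextDeriv θ = s.pullback (𝓡 4) (Subtype.val : U → N))
    (hV : IsOpen V) (hUV : (U : Set N)ᶜ ⊆ V)
    (hr2 : ∀ x ∈ V, ContMDiffAt (𝓡 4) 𝓘(ℝ, ℝ) ∞ r2 x) (hr2U : ∀ x ∈ V, 0 < r2 x ↔ x ∈ U)
    (hh : ∀ x ∈ (U : Set N) ∩ V, ContMDiffAt (𝓡 4) 𝓘(ℝ, ℝ) ∞ h x) (hδ : 0 < δ)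
    (hpos : ∀ x : U, (x : N) ∈ V → r2 x < δ → ∀ u : EuclideanSpace ℝ (Fin 4),
      (∀ w : EuclideanSpace ℝ (Fin 4), s (x : N) ![u, w] = mfderiv (𝓡 4) 𝓘(ℝ, ℝ) r2 (x : N) w) →
      0 < θ x ![u] - mextDeriv (MForm.ofFun (𝓡 4) h) (x : N) ![u]) :
    ∃ (lam : MForm (𝓡 4) U ℝ 1) (g : U → ℝ) (C : ℝ),
      IsSmoothForm lam ∧ mextDeriv lam = s.pullback (𝓡 4) (Subtype.val : U → N) ∧
      ContMDiff (𝓡 4) 𝓘(ℝ, ℝ) ∞ g ∧ (∀ c : ℝ, IsCompact (g ⁻¹' Iic c)) ∧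
      ∀ x : U, C ≤ g x → ∀ v : EuclideanSpace ℝ (Fin 4),
        (∀ w : EuclideanSpace ℝ (Fin 4), mextDeriv lam x ![v, w] = lam x ![w]) →
        (0 : ℝ) < mfderiv (𝓡 4) 𝓘(ℝ, ℝ) g x v := by
  -- a defining function `ρ₀` of the divisor and the scale `ε` with `{ρ₀ < 3ε} ⊆ V`
  obtain ⟨ρ₀, hρ₀, hρ₀nn, hρ₀U⟩ := exists_contMDiff_pos_iff_mem (N := N) U
  obtain ⟨εV, hεV, hεVmem⟩ := exists_pos_lt_imp_mem hρ₀.continuous hρ₀U hV hUV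
  set ε : ℝ := εV / 3 with hεdef
  have hε : 0 < ε := by positivity
  have h3ε : ∀ x, ρ₀ x < 3 * ε → x ∈ V := fun x hx => hεVmem x (by linarith)
  -- the cut-off `χ`
  obtain ⟨χ, hχ, hχ1, hχ0, hχnn, hχle⟩ := exists_cutoff_of_contMDiff hρ₀ hε
  have hχ0' : ∀ x, χ x ≠ 0 → ρ₀ x < 2 * ε := fun x hx =>
    lt_of_not_ge fun h2 => hx (hχ0 x h2)
  -- `χ = 0` near every point of `{ρ₀ > 2ε}`
  have hχev : ∀ x, 2 * ε < ρ₀ x → ∀ᶠ y in 𝓝 x, χ y = 0 := fun x hx =>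
    eventually_of_mem ((isOpen_lt continuous_const hρ₀.continuous).mem_nhds hx)
      fun y hy => hχ0 y (le_of_lt hy)
  -- the new defining function `ρ = χ r2 + (1 - χ) ρ₀`
  set ρ : N → ℝ := fun y => χ y * r2 y + (1 - χ y) * ρ₀ y with hρdef
  have hρ_smooth : ContMDiff (𝓡 4) 𝓘(ℝ, ℝ) ∞ ρ := by
    intro x
    by_cases hx3 : ρ₀ x < 3 * ε
    · exact ((hχ x).mul (hr2 x (h3ε x hx3))).add ((contMDiffAt_const.sub (hχ x)).mul (hρ₀ x))
    · have hx2 : 2 * ε < ρ₀ x := by linarith [not_lt.1 hx3]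
      refine (hρ₀ x).congr_of_eventuallyEq ?_
      filter_upwards [hχev x hx2] with y hy
      simp [hρdef, hy]
  have hρ_eq : ∀ x, ρ₀ x < ε → ρ x = r2 x := fun x hx => by
    simp [hρdef, hχ1 x hx.le]
  have hρ_ev : ∀ x, ρ₀ x < ε → ρ =ᶠ[𝓝 x] r2 := fun x hx =>
    eventually_of_mem ((isOpen_lt hρ₀.continuous continuous_const).mem_nhds hx)
      fun y hy => hρ_eq y hy
  have hρU : ∀ x, 0 < ρ x ↔ x ∈ U := by
    intro x
    constructor
    · intro hx
      by_contra hxU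
      have h0 : ρ₀ x = 0 := le_antisymm (not_lt.1 fun h' => hxU ((hρ₀U x).1 h')) (hρ₀nn x)
      have hxV : x ∈ V := hUV hxU
      have h1 : χ x = 1 := hχ1 x (by rw [h0]; exact hε.le)
      have : ρ x = r2 x := by simp [hρdef, h1]
      rw [this] at hx
      exact hxU ((hr2U x hxV).1 hx)
    · intro hxU
      have hρ₀x : 0 < ρ₀ x := (hρ₀U x).2 hxU
      rcases (hχnn x).eq_or_lt with hχx | hχx
      · have : ρ x = ρ₀ x := by simp [hρdef, ← hχx]
        rwa [this]
      · have hxV : x ∈ V := h3ε x (by linarith [hχ0' x hχx.ne'])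
        have hr2x : 0 < r2 x := (hr2U x hxV).2 hxU
        have h1 : 0 ≤ (1 - χ x) * ρ₀ x := mul_nonneg (by linarith [hχle x]) (hρ₀nn x)
        have h2 : 0 < χ x * r2 x := mul_pos hχx hr2x
        show 0 < χ x * r2 x + (1 - χ x) * ρ₀ x
        linarith
  -- the corrected primitive `lam = θ - d(χ h)`
  set F : U → ℝ := fun y => χ y * h y with hFdef
  have hF : ContMDiff (𝓡 4) 𝓘(ℝ, ℝ) ∞ F := by
    intro x
    by_cases hx3 : ρ₀ x < 3 * ε
    · have hxV : (x : N) ∈ V := h3ε x hx3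
      have hG : ContMDiffAt (𝓡 4) 𝓘(ℝ, ℝ) ∞ (fun y : N => χ y * h y) (x : N) :=
        (hχ (x : N)).mul (hh (x : N) ⟨x.2, hxV⟩)
      exact ContMDiffAt.comp x hG (contMDiff_subtype_val x)
    · have hx2 : 2 * ε < ρ₀ x := by linarith [not_lt.1 hx3]
      have hev : F =ᶠ[𝓝 x] fun _ => 0 := by
        have hO : IsOpen ((Subtype.val : U → N) ⁻¹' {y : N | 2 * ε < ρ₀ y}) :=
          (isOpen_lt continuous_const hρ₀.continuous).preimage continuous_subtype_val
        filter_upwards [hO.mem_nhds (show x ∈ _ from hx2)] with y hy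
        simp [hFdef, hχ0 y (le_of_lt hy)]
      exact contMDiffAt_const.congr_of_eventuallyEq hev
  have hF0 : ∀ y : U, (MForm.ofFun (𝓡 4) F).SmoothAt y := fun y =>
    MForm.smoothAt_ofFun_of_contMDiffAt (hF y)
  have hdF : IsSmoothForm (mextDeriv (MForm.ofFun (𝓡 4) F)) := fun y =>
    MForm.SmoothAt.mextDeriv (Eventually.of_forall hF0)
  set lam : MForm (𝓡 4) U ℝ 1 := θ - mextDeriv (MForm.ofFun (𝓡 4) F) with hlamdef
  have hlam : IsSmoothForm lam := fun y => (hθ y).sub (hdF y)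
  have hdlam : mextDeriv lam = s.pullback (𝓡 4) (Subtype.val : U → N) := by
    funext y
    rw [hlamdef, mextDeriv_sub_apply (hθ y) (hdF y),
      mextDeriv_mextDeriv_of_smoothAt (Eventually.of_forall hF0), sub_zero, hdθ]
  -- near the divisor `lam = θ - dh`
  have hlam_apply : ∀ x : U, ρ₀ x < ε → ∀ u : EuclideanSpace ℝ (Fin 4),
      lam x ![u] = θ x ![u] - mextDeriv (MForm.ofFun (𝓡 4) h) (x : N) ![u] := by
    intro x hx u
    have hxV : (x : N) ∈ V := h3ε x (by linarith)
    have hhx : ContMDiffAt (𝓡 4) 𝓘(ℝ, ℝ) ∞ h (x : N) := hh (x : N) ⟨x.2, hxV⟩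
    -- `F = h ∘ val` near `x`
    have hev : ∀ᶠ y in 𝓝 x, MForm.ofFun (𝓡 4) F y =
        MForm.ofFun (𝓡 4) (h ∘ (Subtype.val : U → N)) y := by
      have hO : IsOpen ((Subtype.val : U → N) ⁻¹' {y : N | ρ₀ y < ε}) :=
        (isOpen_lt hρ₀.continuous continuous_const).preimage continuous_subtype_val
      filter_upwards [hO.mem_nhds (show x ∈ _ from hx)] with y hy
      have hFy : F y = h y := by simp [hFdef, hχ1 y (le_of_lt hy)]
      simp only [MForm.ofFun, Function.comp_apply]
      rw [hFy]
    have hcomp : MDifferentiableAt (𝓡 4) 𝓘(ℝ, ℝ) (h ∘ (Subtype.val : U → N)) x :=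
      (hhx.mdifferentiableAt (by simp)).comp x (OpenSubmanifold.mdifferentiableAt_subtype_val x)
    have hhd : MDifferentiableAt (𝓡 4) 𝓘(ℝ, ℝ) h (x : N) := hhx.mdifferentiableAt (by simp)
    have h1 : mextDeriv (MForm.ofFun (𝓡 4) F) x ![u] =
        mextDeriv (MForm.ofFun (𝓡 4) h) (x : N) ![u] := by
      rw [mextDeriv_congr_of_eventuallyEq hev, mextDeriv_ofFun_apply_eq_mfderiv hcomp,
        mfderiv_comp x hhd (OpenSubmanifold.mdifferentiableAt_subtype_val x),
        OpenSubmanifold.mfderiv_subtype_val, mextDeriv_ofFun_apply_eq_mfderiv hhd]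
      rfl
    rw [← h1, hlamdef]
    rfl
  -- `ρ` is bounded below off `{ρ₀ < ε}`
  obtain ⟨m, hm, hmK⟩ : ∃ m : ℝ, 0 < m ∧ ∀ y ∈ {y : N | ε ≤ ρ₀ y}, m ≤ ρ y := by
    refine exists_pos_forall_le_of_isCompact
      ((isClosed_le continuous_const hρ₀.continuous).isCompact) hρ_smooth.continuous ?_
    intro y hy
    exact (hρU y).2 ((hρ₀U y).1 (hε.trans_le hy))
  have hsmall : ∀ x : U, ρ x < min m δ → ρ₀ x < ε ∧ r2 x < δ := by
    intro x hx
    have h1 : ρ₀ x < ε := lt_of_not_ge fun h' => (hmK x h').not_gt (hx.trans_le (min_le_left _ _))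
    exact ⟨h1, by rw [← hρ_eq x h1]; exact hx.trans_le (min_le_right _ _)⟩
  -- layer A3
  obtain ⟨g, C, hg, hgc, hconv⟩ := exists_exhaustion_of_definingFunction s lam ρ hnd hdlam
    hρ_smooth hρU (lt_min hm hδ) (fun x hx u hu => by
      obtain ⟨hxε, hxδ⟩ := hsmall x hx
      have hxV : (x : N) ∈ V := h3ε x (by linarith)
      have hdρ : mfderiv (𝓡 4) 𝓘(ℝ, ℝ) ρ (x : N) = mfderiv (𝓡 4) 𝓘(ℝ, ℝ) r2 (x : N) :=
        (hρ_ev x hxε).mfderiv_eq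
      have hu' : ∀ w : EuclideanSpace ℝ (Fin 4),
          s (x : N) ![u, w] = mfderiv (𝓡 4) 𝓘(ℝ, ℝ) r2 (x : N) w := fun w => by
        rw [← hdρ]; exact hu w
      rw [hlam_apply x hxε u]
      exact hpos x hxV hxδ u hu')
  exact ⟨lam, g, C, hlam, hdlam, hg, hgc, hconv⟩

end Gluing

end Literature.Geometry.Symplectic
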